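import Mathlib.Analysis.InnerProductSpace.PiL2
import Mathlib.Analysis.Calculus.ContDiff.Comp
import Mathlib.Analysis.Calculus.FDeriv.CompCLM
import Mathlib.Topology.MetricSpace.Holder
import Mathlib.Data.Fintype.BigOperators
import HarnessLib

/-!
# Multilinear forms: operator norms from components; components of iterated derivatives

Two groups of elementary facts used to run Schauder-type bootstraps componentwise.

* **Norms from components.** For a continuous `n`-linear form `A` on a real inner product space
  `E` with a finite orthonormal basis `(e_i)_{i ∈ ι}`, expanding each argument in the basis gives
  `‖A‖ ≤ ∑_{I : Fin n → ι} |A(e_{I 1}, …, e_{I n})|` (`multilinear_norm_le_sum_abs_apply`).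
  Consequently a uniform bound `B` (resp. a Hölder seminorm bound `C`) on every component
  `x ↦ A(x)(e_I)` of a field of `n`-linear forms yields the bound `(card ι)^n B` on `‖A(x)‖`
  (resp. the Hölder constant `(card ι)^n C` for `x ↦ A(x)` in operator norm):
  `norm_multilinear_le_of_components`, `holderOnWith_multilinear_of_components`. This is how
  componentwise Schauder estimates for `D^{m+1}u(e_I)` are turned into estimates of `‖D^{m+1}u‖`.
* **Components of iterated derivatives.** For `u : E → ℝ` of class `C^{n+1}` (resp. `C^{n+2}`)
  at `y` and a fixed tuple `M : Fin n → E`, the scalar function `z ↦ Dⁿu(z)(M)` has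
  `∂_v [Dⁿu(·)(M)](y) = Dⁿ⁺¹u(y)(v, M)` and `∂_v ∂_w [Dⁿu(·)(M)](y) = Dⁿ⁺²u(y)(v, w, M)`, i.e.
  `D²[Dⁿu(·)(M)](y)(v, w) = Dⁿ⁺²u(y)(v, w, M)` (`fderiv_iteratedFDeriv_apply_const`,
  `fderiv_fderiv_iteratedFDeriv_apply_const`, `iteratedFDeriv_two_iteratedFDeriv_apply_const`),
  and it is smooth on any open set where `u` is (`contDiffOn_iteratedFDeriv_apply_const`).
  These follow from Mathlib's `iteratedFDeriv_succ_apply_left` (the first slot of `Dⁿ⁺¹u` is the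
  derivative of `Dⁿu`) and `fderiv_continuousMultilinear_apply_const_apply`; the second-order
  identity needs the first-order one on a neighbourhood of `y`, supplied by `ContDiffAt.eventually`.

Everything here is standard multivariable calculus; all statements are fully proved.

## References

* J. Dieudonné, *Foundations of Modern Analysis*, Academic Press 1960, Ch. VIII §12
  (higher derivatives as symmetric multilinear maps). [Dieudonne1960]
-/

noncomputable section

open Function Metric Set Filter
open scoped NNReal ENNReal ContDiff Topology InnerProductSpace

namespace Literature.Analysis.Calculus

section Norm

variable {ι : Type*} [Fintype ι] {E : Type*} [NormedAddCommGroup E] [InnerProductSpace ℝ E]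

/-- `‖A‖ ≤ ∑_I |A(e_{I₁}, …, e_{I_n})|` for an `n`-linear form and an orthonormal basis `e`.
[folklore] -/
theorem multilinear_norm_le_sum_abs_apply (bE : OrthonormalBasis ι ℝ E) {n : ℕ}
    (A : E [×n]→L[ℝ] ℝ) : ‖A‖ ≤ ∑ I : Fin n → ι, |A (fun k => bE (I k))| := by
  refine ContinuousMultilinearMap.opNorm_le_bound (by positivity) fun v => ?_
  have hv : v = fun k => ∑ i, ⟪bE i, v k⟫_ℝ • bE i := by
    funext k
    exact (bE.sum_repr' (v k)).symm
  conv_lhs => rw [hv]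
  rw [ContinuousMultilinearMap.map_sum A (fun k i => ⟪bE i, v k⟫_ℝ • bE i)]
  simp_rw [ContinuousMultilinearMap.map_smul_univ]
  rw [Real.norm_eq_abs, Finset.sum_mul]
  refine (Finset.abs_sum_le_sum_abs _ _).trans (Finset.sum_le_sum fun I _ => ?_)
  rw [smul_eq_mul, abs_mul, mul_comm]
  refine mul_le_mul_of_nonneg_left ?_ (abs_nonneg _)
  rw [Finset.abs_prod]
  exact Finset.prod_le_prod (fun k _ => abs_nonneg _) fun k _ =>
    (abs_real_inner_le_norm _ _).trans (by rw [bE.orthonormal.1, one_mul])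

/-- Sup bound of a field of `n`-linear forms on a set from bounds of its components: if
`|A(x)(e_I)| ≤ B` on `s` for every multi-index `I`, then `‖A(x)‖ ≤ (card ι)^n · B` on `s`.
[folklore] -/
theorem norm_multilinear_le_of_components (bE : OrthonormalBasis ι ℝ E) {n : ℕ} {X : Type*}
    {A : X → E [×n]→L[ℝ] ℝ} {s : Set X} {B : ℝ}
    (hB : ∀ I : Fin n → ι, ∀ x ∈ s, |A x (fun k => bE (I k))| ≤ B) :
    ∀ x ∈ s, ‖A x‖ ≤ (Fintype.card ι) ^ n * B := by
  intro x hx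
  refine (multilinear_norm_le_sum_abs_apply bE (A x)).trans ?_
  calc ∑ I : Fin n → ι, |A x (fun k => bE (I k))| ≤ ∑ _I : Fin n → ι, B :=
        Finset.sum_le_sum fun I _ => hB I x hx
    _ = (Fintype.card ι) ^ n * B := by
        rw [Finset.sum_const, Finset.card_univ, Fintype.card_fun, Fintype.card_fin, nsmul_eq_mul,
          Nat.cast_pow]

/-- Hölder bound of a field of `n`-linear forms on a set from Hölder bounds of its components:
if every component `x ↦ A(x)(e_I)` is `(C, r)`-Hölder on `s`, then `x ↦ A(x)` is
`((card ι)^n · C, r)`-Hölder on `s` in operator norm. [folklore] -/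
theorem holderOnWith_multilinear_of_components (bE : OrthonormalBasis ι ℝ E) {n : ℕ} {X : Type*}
    [PseudoEMetricSpace X] {A : X → E [×n]→L[ℝ] ℝ} {s : Set X} {C r : ℝ≥0}
    (hC : ∀ I : Fin n → ι, HolderOnWith C r (fun x => A x (fun k => bE (I k))) s) :
    HolderOnWith ((Fintype.card ι) ^ n * C) r A s := by
  intro x hx y hy
  rw [edist_dist, dist_eq_norm]
  have h1 := multilinear_norm_le_sum_abs_apply bE (A x - A y)
  have h2 : ∀ I : Fin n → ι,
      ENNReal.ofReal |(A x - A y) (fun k => bE (I k))| ≤ C * edist x y ^ (r : ℝ) := by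
    intro I
    have := hC I x hx y hy
    rwa [edist_dist, Real.dist_eq, ← sub_apply] at this
  calc ENNReal.ofReal ‖A x - A y‖
        ≤ ENNReal.ofReal (∑ I : Fin n → ι, |(A x - A y) (fun k => bE (I k))|) :=
          ENNReal.ofReal_le_ofReal h1
    _ = ∑ I : Fin n → ι, ENNReal.ofReal |(A x - A y) (fun k => bE (I k))| :=
          ENNReal.ofReal_sum_of_nonneg (fun I _ => abs_nonneg _)
    _ ≤ ∑ _I : Fin n → ι, (C : ℝ≥0∞) * edist x y ^ (r : ℝ) := Finset.sum_le_sum fun I _ => h2 I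
    _ = ((Fintype.card ι ^ n * C : ℝ≥0) : ℝ≥0∞) * edist x y ^ (r : ℝ) := by
        rw [Finset.sum_const, Finset.card_univ, Fintype.card_fun, Fintype.card_fin, nsmul_eq_mul]
        push_cast
        ring

end Norm

section Components

variable {E : Type*} [NormedAddCommGroup E] [NormedSpace ℝ E]

/-- `∂_v [Dⁿu(·)(M)] (y) = Dⁿ⁺¹u(y)(v, M)` for `u` of class `C^{n+1}` at `y` and a fixed tuple
`M`: the derivative of a component of the `n`-th derivative is a component of the `(n+1)`-st.
[folklore] -/
theorem fderiv_iteratedFDeriv_apply_const {n : ℕ} {u : E → ℝ} {y : E}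
    (hu : ContDiffAt ℝ (n + 1 : ℕ) u y) (M : Fin n → E) (v : E) :
    fderiv ℝ (fun z => iteratedFDeriv ℝ n u z M) y v =
      iteratedFDeriv ℝ (n + 1) u y (Fin.cons v M) := by
  have hd : DifferentiableAt ℝ (iteratedFDeriv ℝ n u) y :=
    hu.differentiableAt_iteratedFDeriv (by exact_mod_cast Nat.lt_succ_self n)
  rw [fderiv_continuousMultilinear_apply_const_apply hd M v, iteratedFDeriv_succ_apply_left,
    Fin.cons_zero, Fin.tail_cons]

/-- `∂_v ∂_w [Dⁿu(·)(M)] (y) = Dⁿ⁺²u(y)(v, w, M)` for `u` of class `C^{n+2}` at `y` and a fixed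
tuple `M`. [folklore] -/
theorem fderiv_fderiv_iteratedFDeriv_apply_const {n : ℕ} {u : E → ℝ} {y : E}
    (hu : ContDiffAt ℝ (n + 2 : ℕ) u y) (M : Fin n → E) (v w : E) :
    fderiv ℝ (fderiv ℝ (fun z => iteratedFDeriv ℝ n u z M)) y v w =
      iteratedFDeriv ℝ (n + 2) u y (Fin.cons v (Fin.cons w M)) := by
  -- `g := z ↦ Dⁿu(z)(M)` is `C²` at `y`
  have hg : ContDiffAt ℝ 2 (fun z => iteratedFDeriv ℝ n u z M) y := by
    have h1 : ContDiffAt ℝ 2 (iteratedFDeriv ℝ n u) y :=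
      hu.iteratedFDeriv_right (m := 2) (by push_cast; exact le_of_eq (by ring))
    exact (ContinuousMultilinearMap.apply ℝ (fun _ : Fin n => E) ℝ M).contDiff.comp_contDiffAt
      y h1
  have hdg : DifferentiableAt ℝ (fderiv ℝ (fun z => iteratedFDeriv ℝ n u z M)) y :=
    (hg.fderiv_right (m := 1) le_rfl).differentiableAt one_ne_zero
  -- `∂_v ∂_w g (y) = ∂_v (z ↦ ∂_w g(z)) (y)`
  have hswap : fderiv ℝ (fderiv ℝ (fun z => iteratedFDeriv ℝ n u z M)) y v w =
      fderiv ℝ (fun z => fderiv ℝ (fun z => iteratedFDeriv ℝ n u z M) z w) y v := by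
    rw [fderiv_clm_apply hdg (differentiableAt_const w), fderiv_const_apply]
    simp
  rw [hswap]
  -- near `y`, `∂_w g = Dⁿ⁺¹u(·)(w, M)`
  have hnear : ∀ᶠ z in 𝓝 y, ContDiffAt ℝ (n + 1 : ℕ) u z :=
    (hu.of_le (by exact_mod_cast Nat.le_succ (n + 1))).eventually (by simp)
  have hEq : (fun z => fderiv ℝ (fun z => iteratedFDeriv ℝ n u z M) z w) =ᶠ[𝓝 y]
      fun z => iteratedFDeriv ℝ (n + 1) u z (Fin.cons w M) := by
    filter_upwards [hnear] with z hz
    exact fderiv_iteratedFDeriv_apply_const hz M w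
  rw [hEq.fderiv_eq]
  exact fderiv_iteratedFDeriv_apply_const hu (Fin.cons w M) v

/-- `D²[Dⁿu(·)(M)](y)(v, w) = Dⁿ⁺²u(y)(v, w, M)` in `iteratedFDeriv` form. [folklore] -/
theorem iteratedFDeriv_two_iteratedFDeriv_apply_const {n : ℕ} {u : E → ℝ} {y : E}
    (hu : ContDiffAt ℝ (n + 2 : ℕ) u y) (M : Fin n → E) (v w : E) :
    iteratedFDeriv ℝ 2 (fun z => iteratedFDeriv ℝ n u z M) y ![v, w] =
      iteratedFDeriv ℝ (n + 2) u y (Fin.cons v (Fin.cons w M)) := by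
  rw [iteratedFDeriv_two_apply]
  exact fderiv_fderiv_iteratedFDeriv_apply_const hu M v w

/-- Smoothness of a component `z ↦ Dⁿu(z)(M)` of the `n`-th derivative of a function `u` smooth
on an open set. [folklore] -/
theorem contDiffOn_iteratedFDeriv_apply_const {n : ℕ} {u : E → ℝ} {O : Set E} (hO : IsOpen O)
    (hu : ContDiffOn ℝ ∞ u O) (M : Fin n → E) :
    ContDiffOn ℝ ∞ (fun z => iteratedFDeriv ℝ n u z M) O := by
  intro x hx
  have hux : ContDiffAt ℝ ∞ u x := hu.contDiffAt (hO.mem_nhds hx)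
  have h1 : ContDiffAt ℝ ∞ (iteratedFDeriv ℝ n u) x :=
    hux.iteratedFDeriv_right (m := ∞) (by exact_mod_cast le_top)
  exact ((ContinuousMultilinearMap.apply ℝ (fun _ : Fin n => E) ℝ M).contDiff.comp_contDiffAt
    x h1).contDiffWithinAt

end Components

end Literature.Analysis.Calculus
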